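import Summits.KontsevichZagierPeriods.KontsevichZagierPeriods.Theorems.SymplecticScissorsRealOnePeriodRelationsEllLayer

/-!
# `RealOnePeriodRelations` (stmt-KontsevichZagierPeriods-10042), line `nash-retraction-thin-strip`,
# the loop layer: stub `stub_polyArcs` — polynomial cells are multiples of the unit symbol

For `a < b` real algebraic and `P` a polynomial with real algebraic coefficients, the cell
`ρ = [∫_{(a,b)} P(x) dx]` is, modulo `M₁ = closure (1a ∪ 1b ∪ 2 ∪ Green)`, the real realisation of
`v · 𝟙`, where `𝟙 = (𝔸¹, dx, [0,1])` is the unit symbol and `v = Q(b) − Q(a)` for a polynomial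
antiderivative `Q` of `P` (so that `v` is real algebraic):

* rule 2 along the affine chart `x ↦ (x − a)/(b − a)` of `(a,b)` onto `(0,1)` (`helper_cells_1`)
  turns `ρ` into `[∫_{(0,1)} P(a + (b − a)t)(b − a) dt] = [∫_{(0,1)} u′(t) dt]`,
  `u(t) = Q(a + (b − a)t)`;
* exactness in dimension one (`stub_exactDimOne`, rules 1b and 2 only) turns this into
  `[∫_{(0,1)} (u(1) − u(0)) dt] = [∫_{(0,1)} v dt]`, which is the real realisation
  `[∫_{(0,1)} Re(v · 1 · (d/dt) t) dt]` of `v · 𝟙` supplied by `stub_realises`;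
* the value: evaluation kills `M₁`, so `ρ.value = ∫_{(0,1)} v = v = v · period(𝟙)`.

References: M. Kontsevich, D. Zagier, *Periods* (2001), §1.2 rules (1), (2); A. Huber,
G. Wüstholz, *Transcendence and Linear Relations of 1-Periods* (2022), Lemma 12.4.
-/

noncomputable section

open scoped BigOperators Polynomial
open Set MeasureTheory MvPolynomial
open Literature.NumberTheory.Transcendental Literature.NumberTheory.Transcendental.CurvePeriods
open Literature.ModelTheory.ExponentialFields (IsSemialgebraic)
open Summit.KontsevichZagierPeriods.SymplecticScissors.RealOnePeriodRelationsNegative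
  (M₁ H₁ crux_iff unitDom eval_eq_zero_of_mem_M₁ measurableSet_unitDom volume_unitDom)

namespace Summit.KontsevichZagierPeriods.SymplecticScissors.RealOnePeriodRelations

namespace LoopLayer

namespace PolyArcs

/-- Over a field of characteristic zero every polynomial has a polynomial antiderivative:
`(Σᵢ pᵢ/(i+1) · X^{i+1})′ = Σᵢ pᵢ Xⁱ`. [folklore] -/
theorem exists_derivative_eq {F : Type*} [Field F] [CharZero F] (P : F[X]) :
    ∃ Q : F[X], Polynomial.derivative Q = P := by
  refine ⟨∑ i ∈ Finset.range (P.natDegree + 1),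
    Polynomial.C (P.coeff i / (i + 1)) * Polynomial.X ^ (i + 1), ?_⟩
  rw [Polynomial.derivative_sum]
  conv_rhs => rw [P.as_sum_range_C_mul_X_pow]
  refine Finset.sum_congr rfl fun i _ => ?_
  rw [Polynomial.derivative_C_mul_X_pow, Nat.add_sub_cancel, Nat.cast_add_one,
    div_mul_cancel₀ _ (Nat.cast_add_one_ne_zero i)]

/-- The value of a polynomial with real algebraic coefficients at a real algebraic point is
algebraic: it lies in the relative algebraic closure `ℚ̄ ∩ ℝ` (a subfield of `ℝ`). [folklore] -/
theorem isAlgebraic_aeval {x : ℝ} (hx : IsAlgebraic ℚ x) (R : Polynomial (algebraicClosure ℚ ℝ)) :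
    IsAlgebraic ℚ (Polynomial.aeval x R) := by
  have h := Polynomial.aeval_algebraMap_apply_eq_algebraMap_eval (A := ℝ)
    (⟨x, mem_algebraicClosure_iff.2 hx⟩ : algebraicClosure ℚ ℝ) R
  rw [IntermediateField.algebraMap_apply, IntermediateField.algebraMap_apply] at h
  have h2 : Polynomial.aeval x R =
      ((R.eval ⟨x, mem_algebraicClosure_iff.2 hx⟩ : algebraicClosure ℚ ℝ) : ℝ) := h
  rw [h2]
  exact mem_algebraicClosure_iff.1 (R.eval _).2

/-- A polynomial with real algebraic coefficients composed with a `ℚ`-semialgebraic function is a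
`ℚ`-semialgebraic function (a finite sum of algebraic constants times powers).
[cite: BochnakCosteRoy1998, Prop. 2.2.6] -/
theorem isSemialgebraicFunOn_aeval_comp {m : ℕ} {s : Set (Fin m → ℝ)} (hs : IsSemialgebraic ℚ s)
    {g : (Fin m → ℝ) → ℝ} (hg : IsSemialgebraicFunOn ℚ s g) (R : Polynomial (algebraicClosure ℚ ℝ)) :
    IsSemialgebraicFunOn ℚ s (fun z => Polynomial.aeval (g z) R) := by
  have h := IsSemialgebraicFunOn.fun_finsetSum (Finset.range (R.natDegree + 1)) hs
    (F := fun i z => ((R.coeff i : algebraicClosure ℚ ℝ) : ℝ) * g z ^ i) fun i _ =>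
      (isSemialgebraicFunOn_const_of_isAlgebraic hs (mem_algebraicClosure_iff.1 (R.coeff i).2)).fun_mul
        (hg.fun_pow i)
  refine h.congr fun z _ => ?_
  show ∑ i ∈ Finset.range (R.natDegree + 1), ((R.coeff i : algebraicClosure ℚ ℝ) : ℝ) * g z ^ i = _
  rw [Polynomial.aeval_eq_sum_range]
  refine Finset.sum_congr rfl fun i _ => ?_
  rw [Algebra.smul_def, IntermediateField.algebraMap_apply]

end PolyArcs

open PolyArcs in
/-- **Stub `stub_polyArcs`** — POLYNOMIAL CELLS ARE MULTIPLES OF THE UNIT SYMBOL.  For `a < b` real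
algebraic and `P` a polynomial with real algebraic coefficients, the cell `[∫_{(a,b)} P]` is, modulo
`M₁`, the real realisation of `v · 𝟙` (`𝟙 = (𝔸¹, dx, [0,1])`, `v = Q(b) − Q(a)`, `Q′ = P`): affine
chart `(a,b) → (0,1)` (rule 2), then `stub_exactDimOne` with `u(t) = Q(a + (b − a)t)`, then
`stub_realises` of the unit symbol with coefficient `v`; the value clause follows since evaluation
vanishes on `M₁`. [cite: KontsevichZagier2001, §1.2 rules (1), (2)] [cite: HuberWustholz2022, Lemma 12.4] -/
theorem stub_polyArcs : ∀ (a b : ℝ), IsAlgebraic ℚ a → IsAlgebraic ℚ b → a < b →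
    ∀ (P : Polynomial (algebraicClosure ℚ ℝ)) (ρ : KZ.IntegralRep 1), ρ.domain = {z | z 0 ∈ Set.Ioo a b} →
    (∀ x ∈ Set.Ioo a b, ρ.integrand (fun _ => x) = Polynomial.aeval x P) →
    ∃ (C : PeriodSymbol →₀ ℂ) (R : PeriodSymbol → KZ.IntegralRep 1), (∀ s, IsAlgebraic ℚ (C s)) ∧
      (∀ s ∈ C.support, s = PeriodSymbol.unit) ∧
      (∀ s ∈ C.support, IsSemialgebraicMapOn ℚ {z : Fin 1 → ℝ | z 0 ∈ Set.Icc (0 : ℝ) 1}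
        (fun z => Fin.append (fun i => (s.γ.toFun (z 0) i).re) (fun i => (s.γ.toFun (z 0) i).im))) ∧
      (∀ s ∈ C.support, (R s).domain = {z | z 0 ∈ Set.Ioo (0 : ℝ) 1} ∧ ∀ z ∈ (R s).domain, (R s).integrand z =
        (C s * ∑ i, MvPolynomial.eval (s.γ.toFun (z 0)) (s.ω i) * deriv (fun u => s.γ.toFun u i) (z 0)).re) ∧
      evalCombination C = ((ρ.value : ℝ) : ℂ) ∧ KZ.of ρ - ∑ s ∈ C.support, KZ.of (R s) ∈ M₁ := by
  classical
  intro a b ha hb hab P ρ hdom hint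
  have hba : 0 < b - a := sub_pos.2 hab
  have hba' : b - a ≠ 0 := hba.ne'
  ------------------------------------------------------------------
  -- an antiderivative `Q` of `P`, the primitive `u(t) = Q(a + (b − a)t)` and `v = u 1 − u 0`
  ------------------------------------------------------------------
  obtain ⟨Q, hQ⟩ := exists_derivative_eq P
  obtain ⟨u, hu⟩ : ∃ u : ℝ → ℝ, ∀ t, u t = Polynomial.aeval (a + (b - a) * t) Q := ⟨_, fun _ => rfl⟩
  have hufun : u = fun t => Polynomial.aeval (a + (b - a) * t) Q := funext hu
  have halg_aff : ∀ t : ℝ, IsAlgebraic ℚ t → IsAlgebraic ℚ (a + (b - a) * t) := fun t ht =>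
    ha.add ((hb.sub ha).mul ht)
  have hv_alg : IsAlgebraic ℚ (u 1 - u 0) := by
    rw [hu, hu]
    exact (isAlgebraic_aeval (halg_aff 1 isAlgebraic_one) Q).sub
      (isAlgebraic_aeval (halg_aff 0 isAlgebraic_zero) Q)
  set v : ℝ := u 1 - u 0 with hv
  have hvC : IsAlgebraic ℚ (v : ℂ) := hv_alg.algebraMap
  -- calculus of `u`
  have hu_der : ∀ t, HasDerivAt u (Polynomial.aeval (a + (b - a) * t) P * (b - a)) t := by
    intro t
    have h1 : HasDerivAt (fun t : ℝ => a + (b - a) * t) (b - a) t :=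
      (((hasDerivAt_id' t).const_mul (b - a)).const_add a).congr_deriv (mul_one _)
    have h2 := (Polynomial.hasDerivAt_aeval Q (a + (b - a) * t)).comp t h1
    rw [hQ] at h2
    rw [hufun]
    exact h2
  have hu_deriv : ∀ t, deriv u t = Polynomial.aeval (a + (b - a) * t) P * (b - a) :=
    fun t => (hu_der t).deriv
  have hu_cd : ContDiffOn ℝ 1 u (Icc 0 1) := by
    rw [hufun]
    have h_aff : ContDiff ℝ 1 (fun t : ℝ => a + (b - a) * t) :=
      contDiff_const.add (contDiff_const.mul contDiff_id)
    exact ((Polynomial.contDiff_aeval Q 1).comp h_aff).contDiffOn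
  -- semialgebraicity of `u` on `[0,1]`
  have hIcc : IsSemialgebraic ℚ {z : Fin 1 → ℝ | z 0 ∈ Icc (0 : ℝ) 1} := Realises.isSemialgebraic_IccDom
  have hu_sa : IsSemialgebraicFunOn ℚ {z : Fin 1 → ℝ | z 0 ∈ Icc (0 : ℝ) 1} (fun z => u (z 0)) := by
    have hg : IsSemialgebraicFunOn ℚ {z : Fin 1 → ℝ | z 0 ∈ Icc (0 : ℝ) 1}
        (fun z => a + (b - a) * z 0) :=
      (isSemialgebraicFunOn_const_of_isAlgebraic hIcc ha).fun_add
        ((isSemialgebraicFunOn_const_of_isAlgebraic hIcc (hb.sub ha)).fun_mul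
          (isSemialgebraicFunOn_apply hIcc 0))
    exact (isSemialgebraicFunOn_aeval_comp hIcc hg Q).congr fun z _ => (hu (z 0)).symm
  ------------------------------------------------------------------
  -- the real realisation `R₁ = [∫_{(0,1)} Re(v · 1 · 1) dt]` of `v · 𝟙`
  ------------------------------------------------------------------
  have hSA : IsSemialgebraicMapOn ℚ {z : Fin 1 → ℝ | z 0 ∈ Set.Icc (0 : ℝ) 1}
      (fun z => Fin.append (fun i => (PeriodSymbol.unit.γ.toFun (z 0) i).re)
        (fun i => (PeriodSymbol.unit.γ.toFun (z 0) i).im)) :=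
    RetractionConcat.isSAPath_unitPath
  obtain ⟨R₁, hR₁dom, hR₁⟩ := stub_realises PeriodSymbol.unit.Z PeriodSymbol.unit.γ hSA
    PeriodSymbol.unit.ω PeriodSymbol.unit.ω_algebraic (v : ℂ) hvC
  have hR₁v : ∀ z ∈ R₁.domain, R₁.integrand z = v := fun z hz => by
    rw [hR₁ z hz]
    exact (RetractionCases.unitPath_integrand (v : ℂ) (z 0)).trans (Complex.ofReal_re v)
  ------------------------------------------------------------------
  -- rule 2 along the affine chart `φ(x) = (x − a)(b − a)⁻¹` of `(a,b)` onto `(0,1)`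
  ------------------------------------------------------------------
  obtain ⟨φ, hφ⟩ : ∃ φ : ℝ → ℝ, ∀ x, φ x = (x - a) * (b - a)⁻¹ := ⟨_, fun _ => rfl⟩
  have hφfun : φ = fun x => (x - a) * (b - a)⁻¹ := funext hφ
  have hk : 0 < (b - a)⁻¹ := inv_pos.2 hba
  have hkalg : IsAlgebraic ℚ (b - a)⁻¹ := (hb.sub ha).inv
  have hσ := ρ.isSemialgebraic_domain
  have hmemρ : ∀ p : Fin 1 → ℝ, p ∈ ρ.domain ↔ p 0 ∈ Ioo a b := fun p => by rw [hdom]; rfl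
  have hφs : IsSemialgebraicFunOn ℚ ρ.domain (fun p => φ (p 0)) :=
    (((isSemialgebraicFunOn_apply hσ 0).fun_sub (isSemialgebraicFunOn_const_of_isAlgebraic hσ ha)).fun_mul
      (isSemialgebraicFunOn_const_of_isAlgebraic hσ hkalg)).congr fun p _ => (hφ (p 0)).symm
  have hφ's : IsSemialgebraicFunOn ℚ ρ.domain (fun _ => (b - a)⁻¹) :=
    isSemialgebraicFunOn_const_of_isAlgebraic hσ hkalg
  have hder : ∀ x : ℝ, HasDerivAt φ (b - a)⁻¹ x := fun x => by
    rw [hφfun]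
    simpa using ((hasDerivAt_id x).sub_const a).mul_const (b - a)⁻¹
  have hφinv : ∀ t, φ (a + (b - a) * t) = t := fun t => by
    rw [hφ, add_sub_cancel_left, mul_comm, inv_mul_cancel_left₀ hba']
  have hinvφ : ∀ x, a + (b - a) * φ x = x := fun x => by
    rw [hφ, mul_comm (x - a), mul_inv_cancel_left₀ hba', add_sub_cancel]
  have hinj : InjOn (fun p : Fin 1 → ℝ => fun _ : Fin 1 => φ (p 0)) ρ.domain := by
    intro p _ q _ hpq
    have h0 : φ (p 0) = φ (q 0) := congr_fun hpq 0
    have h1 : p 0 = q 0 := by rw [← hinvφ (p 0), h0, hinvφ]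
    rw [KZ.eq_const_apply_zero p, KZ.eq_const_apply_zero q, h1]
  obtain ⟨s, hsdom, hsi, hrel⟩ := helper_cells_1 ρ φ (fun _ => (b - a)⁻¹) hφs hφ's
    (fun p _ => hder (p 0)) (fun _ _ => hk.ne') hinj
  -- the push-forward `s` lives on `(0,1)` …
  have hφmem : ∀ x ∈ Ioo a b, φ x ∈ Ioo (0 : ℝ) 1 := fun x hx => by
    rw [hφ, ← div_eq_mul_inv]
    exact ⟨div_pos (sub_pos.2 hx.1) hba, (div_lt_one hba).2 (by linarith [hx.2])⟩
  have haffmem : ∀ t ∈ Ioo (0 : ℝ) 1, a + (b - a) * t ∈ Ioo a b := fun t ht =>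
    ⟨by nlinarith [mul_pos hba ht.1], by nlinarith [mul_pos hba (sub_pos.2 ht.2)]⟩
  have hs01 : s.domain = {z | z 0 ∈ Ioo (0 : ℝ) 1} := by
    rw [hsdom]
    ext z
    constructor
    · rintro ⟨p, hp, rfl⟩
      exact hφmem _ ((hmemρ p).1 hp)
    · intro hz
      refine ⟨fun _ => a + (b - a) * z 0, (hmemρ _).2 (haffmem _ hz), ?_⟩
      funext i
      show φ (a + (b - a) * z 0) = z i
      rw [hφinv, Subsingleton.elim i 0]
  -- … with integrand `P(a + (b − a)t)·(b − a) = u′(t)`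
  have hsint : ∀ z ∈ s.domain, s.integrand z = deriv u (z 0) := by
    intro z hz
    have hz' : z 0 ∈ Ioo (0 : ℝ) 1 := by rw [hs01] at hz; exact hz
    have hp : (fun _ : Fin 1 => a + (b - a) * z 0) ∈ ρ.domain := (hmemρ _).2 (haffmem _ hz')
    have h := hsi _ hp
    simp only [hφinv] at h
    rw [← KZ.eq_const_apply_zero z, hint _ (haffmem _ hz'), abs_of_pos hk, div_inv_eq_mul] at h
    rw [h, hu_deriv]
  ------------------------------------------------------------------
  -- exactness in dimension one: `[s] − [R₁] ∈ M₁`, hence `[ρ] − [R₁] ∈ M₁`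
  ------------------------------------------------------------------
  have hexact : KZ.of s - KZ.of R₁ ∈ M₁ :=
    stub_exactDimOne u hu_sa hu_cd s R₁ hs01 hR₁dom hsint fun z hz => (hR₁v z hz).trans hv
  have hρR₁ : KZ.of ρ - KZ.of R₁ ∈ M₁ := by
    have e : KZ.of ρ - KZ.of R₁ = (KZ.of ρ - KZ.of s) + (KZ.of s - KZ.of R₁) := by abel
    rw [e]
    exact M₁.add_mem hrel hexact
  ------------------------------------------------------------------
  -- values: `R₁.value = ∫_{(0,1)} v = v` and `ρ.value = R₁.value`
  ------------------------------------------------------------------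
  have hR₁val : R₁.value = v := by
    rw [KZ.IntegralRep.value]
    have hms : MeasurableSet R₁.domain := by
      rw [hR₁dom]
      exact measurableSet_unitDom
    have hvol : volume R₁.domain = 1 := by
      rw [hR₁dom]
      exact volume_unitDom
    have h1 : ∫ x in R₁.domain, R₁.integrand x = ∫ _ in R₁.domain, v :=
      setIntegral_congr_fun hms fun z hz => hR₁v z hz
    rw [h1, setIntegral_const]
    simp [Measure.real, hvol]
  have hval : ρ.value = v := by
    have h := eval_eq_zero_of_mem_M₁ hρR₁
    rw [map_sub, KZ.eval_of, KZ.eval_of, sub_eq_zero] at h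
    rw [h, hR₁val]
  ------------------------------------------------------------------
  -- assemble: `C = v · δ_𝟙`, `R ≡ R₁`
  ------------------------------------------------------------------
  refine ⟨Finsupp.single PeriodSymbol.unit (v : ℂ), fun _ => R₁, ?_, ?_, ?_, ?_, ?_, ?_⟩
  · intro t
    rw [Finsupp.single_apply]
    split_ifs
    · exact hvC
    · exact isAlgebraic_zero
  · exact fun t ht => Finset.mem_singleton.1 (Finsupp.support_single_subset ht)
  · intro t ht
    obtain rfl : t = PeriodSymbol.unit := Finset.mem_singleton.1 (Finsupp.support_single_subset ht)
    exact hSA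
  · intro t ht
    obtain rfl : t = PeriodSymbol.unit := Finset.mem_singleton.1 (Finsupp.support_single_subset ht)
    refine ⟨hR₁dom, fun z hz => ?_⟩
    rw [Finsupp.single_eq_same]
    exact hR₁ z hz
  · rw [evalCombination_single, period_unit, mul_one, hval]
  · by_cases hv0 : v = 0
    · have hsupp : (Finsupp.single PeriodSymbol.unit (v : ℂ)).support = ∅ := by
        rw [hv0, Complex.ofReal_zero, Finsupp.single_zero, Finsupp.support_zero]
      rw [hsupp, Finset.sum_empty, sub_zero]
      have hR₁0 : KZ.of R₁ ∈ M₁ :=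
        HomotopyInvariance.of_mem_of_integrand_zero R₁ fun z hz => by rw [hR₁v z hz, hv0]
      have h := M₁.add_mem hρR₁ hR₁0
      rwa [sub_add_cancel] at h
    · rw [Finsupp.support_single _ (Complex.ofReal_ne_zero.2 hv0), Finset.sum_singleton]
      exact hρR₁

end LoopLayer

end Summit.KontsevichZagierPeriods.SymplecticScissors.RealOnePeriodRelations

end
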